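import Literature.Probability.FitznerVanDerHofstad2017.NobleAssumptions
import HarnessLib

/-!
# The `κ`-summed NoBLE relations with the non-backtracking count `2d − 1` for percolation:
# a kernel proof of `NobleRelationSummedAt d p` on `0 < p < p_c` ([FitznerVanDerHofstad2017], proof of Lemma 5.1)

`NobleRelationSummedAt d p` (module `NobleAssumptions`) is the pair of `κ`-summed relations
`Σ_κ Ψ^{(N),κ}_p(x) ≤ (2d−1)(p/μ_p) Ξ^{(N)}_p(x)` and `Σ_κ Π^{(N),ι,κ}_p(x) ≤ (2d−1) p Ξ^{(N),ι}_p(x)` between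
the completed NoBLE coefficients of [FitznerVanDerHofstad2017, §3.3] (typed in
`Literature.Barriers.CriticalPhenomena.LaceExpansionNobleCoefficients`).  It was so far only a HYPOTHESIS of the
tree (binder `hSum` of `nobleImprovementInputsAt_of_prop45ii`; the packet's divergence D43).  This module PROVES it
for every `d ≥ 2` and every `0 < p < p_c`:
`nobleRelationSummedAt_of_lt_criticalProbI : 2 ≤ d → 0 < p → p < p_c → NobleRelationSummedAt d p`.
Corollary (rev 2): `nobleImprovementInputsAt_of_prop45ii_summed` = the bookkeeping theorem
`nobleImprovementInputsAt_of_prop45ii` of `NobleAssumptions` with its binder `hSum` discharged.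

SOURCE.  [FitznerVanDerHofstad2017], proof of Lemma 5.1 (Bounds on `Ξ^{(1)}_p` and `Ψ^{(1),κ}_p`), verbatim
(arXiv:1506.07977v2 §6.1; held text `paper:arxiv-1506.07977` chunk 35 ll. 7–19): "The coefficients `Ξ^{(1)}_{R,p}`
and `Ψ^{(1),κ}_{R,II,p}` only differ by the factor `p/μ_p` and the constraint that `x+e_κ ∉ C̃_1^{(x,x+e_κ)}`. The
constraint is created by the next pivotal bond `b_1=(x,x+e_κ)` in the expansion, see Section 3. For each
realisation at most `2d−1` values of `κ` can contribute, so that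
`Σ_κ Ψ^{(1),κ}_{R,II,p}(x) ≤ (2d−1)(p/μ_p) Ξ^{(1)}_{R,p}(x)` for all `x`. […] The argument […] also implies that
`Σ_κ Ψ^{(N),κ}_p(x) ≤ (2d−1)(p/μ_p) Ξ^{(N)}_p(x)`."  The `Π`-relation is the same count applied to
`Π^{(N),ι,κ}` versus `Ξ^{(N),ι}` ((3.53), (3.55)–(3.56)); it is not displayed in print ([FitznerVanDerHofstad2017, §5]:
the bounds on `Π^{(N),ι,κ}` "follow from" the per-`κ` relation (3.74)) and is how the published notebook
`Percolation.nb` converts `Π̂` into `Ξ̂^ι` (factor `(2d−1)/(2d)·μ̄`).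

THE PROOF ("at most `2d−1` values of `κ` contribute").  The innermost kernel of `Ψ^{B,(N),κ}` is the
`P^{B(w)}`-probability of `E'(v,y;A) ∩ {y − e_κ ∉ C̃^{(y,y−e_κ)}(v)}` (read off `B(w)`), that of `Ξ^{B,(N)}` the
probability of `E'(v,y;A)`; all outer levels of the two nestings coincide (`nobleOp`, `nobleIter`).  On `E'(v,y;A)`
with `v ≠ y` there is an open path from `v` to `y` made of lattice bonds (a.s. `ω ⊆` edges of `ℤ^d`); its last bond
is `(y − e_{κ₀}, y)` for some direction `κ₀`, and the path minus that bond joins `v` to `y − e_{κ₀}` without using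
it, i.e. `y − e_{κ₀} ∈ C̃^{(y,y−e_{κ₀})}(v)`: the direction `κ₀` does NOT contribute.  Hence, pointwise a.s.,
`Σ_κ 𝟙{E' ∩ (y−e_κ ∉ C̃)} ≤ (2d−1) 𝟙{E'}` (`sum_measure_laceE_inter_le`), which integrates to the kernel inequality
`Σ_κ nobleKerPsi_κ ≤ (2d−1) nobleKerXi` whenever `v ∉ A` (for `v = y ∉ A` the event `E'(v,v;A)` is empty).  The
side condition `v ∉ A` is exactly what the indicator `𝟙{b̄ ∉ C̃ ∪ A′}` of the enclosing level supplies, so the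
inequality propagates through `nobleOp` (superadditivity and monotonicity of the lower Lebesgue integral, no
measurability of the inner kernels needed) and through the `𝔼_0^{b_ι}`-correction of (3.55)–(3.56) (indicator
`𝟙{e_ι ∉ C̃^{b_ι}_0(0)}`).  At the outermost level the start vertex is `0` with `A = {0}` resp. `A = {e_ι}`: for
`N = 0` the completed coefficients vanish at `x = 0` (factor `1 − δ_{0,x}`, (3.41)–(3.42)) resp. `e_ι ≠ 0`, and for
`N ≥ 1` no side condition is needed.  Finiteness below `p_c` (`nobleXiT_ne_top`, `nobleXiIotaT_ne_top`) and
`μ_p > 0` (`nobleMu_pos`) convert the `[0,∞]`-inequalities into the real ones of `NobleRelationSummedAt`.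

NOT HERE: the sharper `N = 0` count `2d − 2` of [FitznerVanDerHofstad2017, (4.6)] (two bond-disjoint paths), the
per-`κ` relations (3.74) (tree: `noblePsiN_le`, `noblePiN_le`), anything at `p = p_c`.

## References

* R. Fitzner, R. van der Hofstad, Mean-field behavior for nearest-neighbor percolation in `d > 10`, Electron. J.
  Probab. 22 (2017) no. 43 (arXiv:1506.07977v2): proof of Lemma 5.1 (§6.1 of arXiv v2), (3.31)–(3.33), (3.41)–(3.43),
  (3.53)–(3.56), §5 (3.74).
* R. Fitzner, R. van der Hofstad, Generalized approach to the non-backtracking lace expansion, Probab. Theory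
  Relat. Fields 169 (2017) 1041–1119: Assumption 4.2 (pp. 1085–1086) and App. D (the `κ`-sums enter (D.9)–(D.12)).
-/

noncomputable section

namespace Literature.Probability.FitznerVanDerHofstad2017

open _root_.MeasureTheory Literature.Barriers.CriticalPhenomena Literature.Probability.Percolation
open Literature.Probability.LatticeModels
open scoped BigOperators ENNReal

variable {d : ℕ}

/-! ### A. The last lattice step of an open path -/

/-- A unit step `e_ι` of `ℤ^d` (`Percolation.stepVec ι`, `ι ∈ {1,…,d} × {±}`) is not the zero vector (the
`Dir d`-version `SAWLace.stepVec_ne_zero` of `LaceExpansionSAWIdentity` is outside this module's imports). [folklore] -/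
theorem percolationStepVec_ne_zero (ι : Fin d × Bool) : Percolation.stepVec ι ≠ (0 : Site d) := by
  intro h
  have h1 := congrFun h ι.1
  unfold Percolation.stepVec at h1
  split_ifs at h1 <;> simp at h1

/-- `E'(v,v;A)` can only occur if `v ∈ A` (`{v ↔ v through A} = {v ∈ A}`).
[cite: HeydenreichVanDerHofstad2017, Def. 6.2(b) and (6.2.11)] -/
theorem mem_of_mem_laceE_self {A : Set (Site d)} {v : Site d} {ω : BondConfig (Site d)}
    (h : ω ∈ laceE A v v) : v ∈ A := by
  by_contra hv
  exact h.1.2 ⟨hv, hv, SimpleGraph.Reachable.refl _⟩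

/-- **The last bond of an open lattice path.**  If `ω` consists of bonds of `ℤ^d` and `v ↔ y` in `ω` with
`v ≠ y`, then for some direction `κ` the vertex `y − e_κ` is joined to `v` without using the bond `(y − e_κ, y)`,
i.e. `y − e_κ ∈ C̃^{(y, y−e_κ)}(v)` (take a self-avoiding open path from `v` to `y` and delete its last bond).
[cite: FitznerVanDerHofstad2017, proof of Lemma 5.1 (arXiv:1506.07977v2 §6.1: "The constraint is created by the next pivotal bond … For each realisation at most 2d−1 values of κ can contribute")] -/
theorem exists_lastStep_mem_restrCluster {ω : BondConfig (Site d)} (hω : ω ⊆ (zdGraph d).edgeSet)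
    {v y : Site d} (hvy : v ≠ y) (h : (openGraph ω).Reachable v y) :
    ∃ κ : Fin d × Bool,
      y - Percolation.stepVec κ ∈ restrCluster y (y - Percolation.stepVec κ) v ω := by
  classical
  obtain ⟨q⟩ := h.symm
  obtain ⟨pth, hpth⟩ : ∃ pth : (openGraph ω).Walk y v, pth.IsPath := ⟨q.bypass, q.bypass_isPath⟩
  cases pth with
  | nil => exact (hvy rfl).elim
  | cons hadj r =>
    rename_i z
    rw [SimpleGraph.Walk.cons_isPath_iff] at hpth
    obtain ⟨-, hy⟩ := hpth
    have hz : s(y, z) ∈ ω := ((openGraph_adj ω y z).1 hadj).1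
    have hadj' : (zdGraph d).Adj z y := (((zdGraph d).mem_edgeSet).1 (hω hz)).symm
    obtain ⟨κ, hκ⟩ := (zdGraph_adj_iff_stepVec z y).1 hadj'
    refine ⟨κ, ?_⟩
    have hzy : y - Percolation.stepVec κ = z := by rw [hκ, add_sub_cancel_right]
    rw [hzy, mem_restrCluster_iff]
    have hre : ∀ e ∈ r.edges, e ∉ ({s(y, z)} : Set (Sym2 (Site d))) := by
      intro e he heq
      rw [Set.mem_singleton_iff] at heq
      subst heq
      exact hy (r.fst_mem_support_of_mem_edges he)
    have hle : (openGraph ω).deleteEdges {s(y, z)} ≤ openGraph (ω \ {s(y, z)}) := by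
      intro a b hab
      rw [SimpleGraph.deleteEdges_adj, openGraph_adj] at hab
      rw [openGraph_adj]
      exact ⟨⟨hab.1.1, hab.2⟩, hab.1.2⟩
    exact ((r.toDeleteEdges {s(y, z)} hre).reachable.mono hle).symm

/-! ### B. "At most `2d − 1` values of `κ` contribute": the innermost inequality -/

/-- Superadditivity of the lower Lebesgue integral over a finite sum (no measurability needed). [folklore] -/
theorem sum_lintegral_le_lintegral_sum {α ι : Type*} [MeasurableSpace α] (μ : Measure α) (s : Finset ι)
    (f : ι → α → ℝ≥0∞) : ∑ i ∈ s, ∫⁻ a, f i a ∂μ ≤ ∫⁻ a, ∑ i ∈ s, f i a ∂μ := by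
  classical
  induction s using Finset.induction_on with
  | empty => simp
  | insert i s hi ih =>
    rw [Finset.sum_insert hi]
    calc ∫⁻ a, f i a ∂μ + ∑ j ∈ s, ∫⁻ a, f j a ∂μ
        ≤ ∫⁻ a, f i a ∂μ + ∫⁻ a, ∑ j ∈ s, f j a ∂μ := add_le_add le_rfl ih
      _ ≤ ∫⁻ a, f i a + ∑ j ∈ s, f j a ∂μ := le_lintegral_add _ _
      _ = ∫⁻ a, ∑ j ∈ insert i s, f j a ∂μ := by simp only [Finset.sum_insert hi]

/-- **At most `2d − 1` directions contribute.**  For the event `E = {E'(v,y;A) occurs off B}` and the constraints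
`F_κ = {y − e_κ ∉ C̃^{(y,y−e_κ)}(v)(ω_{B^c})}`: `Σ_κ P_p(E ∩ F_κ) ≤ (2d−1) P_p(E)`, provided `v ∉ A` in case
`v = y` (then `E = ∅`).  Pointwise a.s.: on `E` the last bond `(y−e_{κ₀}, y)` of an open lattice path from `v`
to `y` in `ω_{B^c}` violates `F_{κ₀}`.
[cite: FitznerVanDerHofstad2017, proof of Lemma 5.1 (arXiv:1506.07977v2 §6.1: "For each realisation at most 2d−1 values of κ can contribute")] -/
theorem sum_measure_laceE_inter_le (p : unitInterval) (B : Set (Sym2 (Site d))) (A : Set (Site d))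
    {v y : Site d} (hvy : v = y → v ∉ A) :
    ∑ κ, bondPercolation (zdGraph d) p
        ({ω | offBonds B ω ∈ laceE A v y} ∩
          {ω | y - Percolation.stepVec κ ∉
            restrCluster y (y - Percolation.stepVec κ) v (offBonds B ω)}) ≤
      ((2 * d - 1 : ℕ) : ℝ≥0∞) * bondPercolation (zdGraph d) p {ω | offBonds B ω ∈ laceE A v y} := by
  classical
  set μ := bondPercolation (zdGraph d) p with hμ
  set E : Set (BondConfig (Site d)) := {ω | offBonds B ω ∈ laceE A v y} with hE
  set F : Fin d × Bool → Set (BondConfig (Site d)) := fun κ =>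
    {ω | y - Percolation.stepVec κ ∉ restrCluster y (y - Percolation.stepVec κ) v (offBonds B ω)} with hF
  have hEm : MeasurableSet E := measurableSet_occursOff B (measurableSet_laceE A v y)
  have hFm : ∀ κ, MeasurableSet (F κ) := fun κ => by
    have h : Measurable fun ω : BondConfig (Site d) =>
        restrCluster y (y - Percolation.stepVec κ) v (offBonds B ω) :=
      (measurable_restrCluster _ _ _).comp (measurable_offBonds B)
    have h1 : MeasurableSet {ω : BondConfig (Site d) |
        y - Percolation.stepVec κ ∈ restrCluster y (y - Percolation.stepVec κ) v (offBonds B ω)} :=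
      measurableSet_setOf.2 (measurable_set_iff.1 h _)
    simpa only [hF, Set.compl_setOf] using h1.compl
  have hpt : ∀ᵐ ω ∂μ, ∑ κ, (E ∩ F κ).indicator 1 ω ≤ E.indicator (fun _ => ((2 * d - 1 : ℕ) : ℝ≥0∞)) ω := by
    have hae : ∀ᵐ ω ∂μ, ω ⊆ (zdGraph d).edgeSet := ProbabilityTheory.setBernoulli_ae_subset
    filter_upwards [hae] with ω hω
    by_cases hωE : ω ∈ E
    · rw [Set.indicator_of_mem hωE]
      have hvy' : v ≠ y := by
        rintro rfl
        exact hvy rfl (mem_of_mem_laceE_self hωE)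
      obtain ⟨κ₀, hκ₀⟩ := exists_lastStep_mem_restrCluster (offBonds_subset_edgeSet hω B) hvy'
        (laceE_subset_openConn A v y hωE)
      have hnot : ω ∉ F κ₀ := fun h => h hκ₀
      have hcard : (Finset.univ.erase κ₀).card = 2 * d - 1 := by
        rw [Finset.card_erase_of_mem (Finset.mem_univ _), Finset.card_univ, Fintype.card_prod,
          Fintype.card_fin, Fintype.card_bool, mul_comm]
      calc ∑ κ, (E ∩ F κ).indicator 1 ω
          = ∑ κ ∈ Finset.univ.erase κ₀, (E ∩ F κ).indicator 1 ω := by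
            rw [Finset.sum_erase]
            exact Set.indicator_of_notMem (fun h => hnot h.2) _
        _ ≤ ∑ κ ∈ Finset.univ.erase κ₀, (1 : ℝ≥0∞) :=
            Finset.sum_le_sum fun κ _ => Set.indicator_apply_le' (fun _ => le_rfl) (fun _ => zero_le_one)
        _ = ((2 * d - 1 : ℕ) : ℝ≥0∞) := by
            rw [Finset.sum_const, hcard, nsmul_eq_mul, mul_one]
    · have h0 : ∀ κ, (E ∩ F κ).indicator (1 : BondConfig (Site d) → ℝ≥0∞) ω = 0 := fun κ =>
        Set.indicator_of_notMem (fun h => hωE h.1) _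
      simp only [h0, Finset.sum_const_zero, zero_le]
  calc ∑ κ, μ (E ∩ F κ) = ∑ κ, ∫⁻ ω, (E ∩ F κ).indicator 1 ω ∂μ := by
        simp_rw [lintegral_indicator_one (hEm.inter (hFm _))]
    _ = ∫⁻ ω, ∑ κ, (E ∩ F κ).indicator 1 ω ∂μ :=
        (lintegral_finsetSum _ fun κ _ => measurable_one.indicator (hEm.inter (hFm κ))).symm
    _ ≤ ∫⁻ ω, E.indicator (fun _ => ((2 * d - 1 : ℕ) : ℝ≥0∞)) ω ∂μ := lintegral_mono_ae hpt
    _ = ((2 * d - 1 : ℕ) : ℝ≥0∞) * μ E := lintegral_indicator_const hEm _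

/-- **The innermost kernels**: `Σ_κ nobleKerPsi_κ(w,A,v,x) ≤ (2d−1) · nobleKerXi(w,A,v,x)` for `v ∉ A` (the
indicator `𝟙{x−e_κ ∉ C̃ ∪ {w}}` of (3.32) is at most `𝟙{x−e_κ ∉ C̃}`).
[cite: FitznerVanDerHofstad2017, (3.31)–(3.32) (arXiv:1506.07977v2 p. 27) and proof of Lemma 5.1 (§6.1)] -/
theorem sum_nobleKerPsi_le (p : unitInterval) (w : Site d) (A : Set (Site d)) {v x : Site d} (hv : v ∉ A) :
    ∑ κ, nobleKerPsi d p (Percolation.stepVec κ) w A v x ≤ ((2 * d - 1 : ℕ) : ℝ≥0∞) * nobleKerXi d p w A v x := by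
  rw [nobleKerXi_apply, probOff_def]
  refine le_trans (Finset.sum_le_sum fun κ _ => ?_) (sum_measure_laceE_inter_le p (bondsAt {w}) A (fun _ => hv))
  rw [nobleKerPsi_apply]
  exact measure_mono fun ω h => ⟨h.1, fun hm => h.2 (Set.mem_union_left _ hm)⟩

/-! ### C. Propagation through the nesting -/

/-- **One level of the nesting preserves the summed inequality**: if `Σ_κ h_κ(w,A,v,x) ≤ m·h'(w,A,v,x)` whenever
`v ∉ A`, then `Σ_κ 𝒩^{B,A′}h_κ ≤ m·𝒩^{B,A′}h'` everywhere — the cell indicator `𝟙{u′ ∉ C̃^{(u,u′)}(v) ∪ A′}`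
supplies the side condition of the inner level.  (Superadditivity and monotonicity of `∫⁻`; no measurability of
the kernels is used.) [cite: FitznerVanDerHofstad2017, (3.26), (3.31)–(3.33) (arXiv:1506.07977v2 pp. 26–27)] -/
theorem sum_nobleOp_le (p : unitInterval) {m : ℝ≥0∞} (hm : m ≠ ∞) {hs : Fin d × Bool → NobleKernel d}
    {h' : NobleKernel d} (hgood : ∀ w A v x, v ∉ A → ∑ κ, hs κ w A v x ≤ m * h' w A v x)
    (B : Set (Sym2 (Site d))) (A' A : Set (Site d)) (v x : Site d) :
    ∑ κ, nobleOp d p B A' (hs κ) A v x ≤ m * nobleOp d p B A' h' A v x := by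
  simp only [nobleOp_apply]
  rw [← Summable.tsum_finsetSum (fun _ _ => ENNReal.summable), ← ENNReal.tsum_mul_left]
  refine ENNReal.tsum_le_tsum fun b => ?_
  rw [← Finset.mul_sum, mul_left_comm]
  refine mul_le_mul' le_rfl ?_
  refine le_trans (sum_lintegral_le_lintegral_sum _ _ _) ?_
  rw [← lintegral_const_mul' _ _ hm]
  refine lintegral_mono fun ω => ?_
  by_cases hω : ω ∈ nobleCell B A' A v b.1 b.2
  · simp only [Set.indicator_of_mem hω]
    exact hgood _ _ _ _ hω.2
  · simp only [Set.indicator_of_notMem hω, Finset.sum_const_zero, zero_le]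

/-- The iterates `𝒩ⁿ` preserve the summed inequality (induction on `n` with `sum_nobleOp_le`).
[cite: FitznerVanDerHofstad2017, (3.30)–(3.33) (arXiv:1506.07977v2 pp. 26–27)] -/
theorem sum_nobleIter_le (p : unitInterval) {m : ℝ≥0∞} (hm : m ≠ ∞) {hs : Fin d × Bool → NobleKernel d}
    {h' : NobleKernel d} (hgood : ∀ w A v x, v ∉ A → ∑ κ, hs κ w A v x ≤ m * h' w A v x) (n : ℕ) :
    ∀ w A v x, v ∉ A → ∑ κ, nobleIter d p (hs κ) n w A v x ≤ m * nobleIter d p h' n w A v x := by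
  induction n with
  | zero => simpa only [nobleIter_zero] using hgood
  | succ n ih =>
    intro w A v x _
    simp only [nobleIter_succ, nobleOpW_apply]
    exact sum_nobleOp_le p hm ih (bondsAt {w}) {w} A v x

/-- **`Σ_κ Ψ^{B,(0),κ}(v,y;A) ≤ (2d−1) Ξ^{B,(0)}(v,y;A)`** provided `v ∉ A` in case `v = y`.
[cite: FitznerVanDerHofstad2017, (3.23)–(3.24) (arXiv:1506.07977v2 p. 25) and proof of Lemma 5.1 (§6.1)] -/
theorem sum_noblePsiBT_zero_le (p : unitInterval) (B : Set (Sym2 (Site d))) (A' A : Set (Site d)) {v y : Site d}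
    (hvy : v = y → v ∉ A) :
    ∑ κ, noblePsiBT d p B A' (Percolation.stepVec κ) 0 A v y ≤
      ((2 * d - 1 : ℕ) : ℝ≥0∞) * nobleXiBT d p B A' 0 A v y := by
  rw [nobleXiBT_zero, probOff_def]
  refine le_trans (Finset.sum_le_sum fun κ _ => ?_) (sum_measure_laceE_inter_le p B A hvy)
  rw [noblePsiBT_zero]
  exact measure_mono fun ω h => ⟨h.2.1, h.2.2⟩

/-- **`Σ_κ Ψ^{B,(N+1),κ}(v,y;A) ≤ (2d−1) Ξ^{B,(N+1)}(v,y;A)`** for every `B, A′, A, v, y` (no side condition: the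
outermost cell indicator supplies it to the inner levels).
[cite: FitznerVanDerHofstad2017, (3.31)–(3.32) (arXiv:1506.07977v2 p. 27) and proof of Lemma 5.1 (§6.1: "The argument … also implies that Σ_κ Ψ^{(N),κ}_p(x) ≤ (2d−1)(p/μ_p)Ξ^{(N)}_p(x)")] -/
theorem sum_noblePsiBT_succ_le (p : unitInterval) (B : Set (Sym2 (Site d))) (A' A : Set (Site d)) (N : ℕ)
    (v y : Site d) :
    ∑ κ, noblePsiBT d p B A' (Percolation.stepVec κ) (N + 1) A v y ≤
      ((2 * d - 1 : ℕ) : ℝ≥0∞) * nobleXiBT d p B A' (N + 1) A v y := by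
  simp only [noblePsiBT_succ, nobleXiBT_succ]
  exact sum_nobleOp_le p (ENNReal.natCast_ne_top _)
    (sum_nobleIter_le p (ENNReal.natCast_ne_top _) (fun w A v x hv => sum_nobleKerPsi_le p w A hv) N) B A' A v y

/-- **`Σ_κ Ψ^{B,(N),κ}(v,y;A) ≤ (2d−1) Ξ^{B,(N)}(v,y;A)`** for all `N`, provided `v ∉ A` in case `v = y`.
[cite: FitznerVanDerHofstad2017, proof of Lemma 5.1 (arXiv:1506.07977v2 §6.1)] -/
theorem sum_noblePsiBT_le (p : unitInterval) (B : Set (Sym2 (Site d))) (A' A : Set (Site d)) (N : ℕ)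
    {v y : Site d} (hvy : v = y → v ∉ A) :
    ∑ κ, noblePsiBT d p B A' (Percolation.stepVec κ) N A v y ≤
      ((2 * d - 1 : ℕ) : ℝ≥0∞) * nobleXiBT d p B A' N A v y := by
  cases N with
  | zero => exact sum_noblePsiBT_zero_le p B A' A hvy
  | succ N => exact sum_noblePsiBT_succ_le p B A' A N v y

/-- The `𝔼_0^{b_ι}`-correction of (3.55)–(3.56) preserves the summed inequality: its indicator
`𝟙{e_ι ∉ C̃^{b_ι}_0(0)}` supplies the side condition `e_ι ∉ C` of the inner coefficient.
[cite: FitznerVanDerHofstad2017, (3.55)–(3.56) (arXiv:1506.07977v2 p. 30)] -/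
theorem sum_nobleIotaCorr_le (p : unitInterval) (e : Site d) {m : ℝ≥0∞} (hm : m ≠ ∞)
    {Gs : Fin d × Bool → Set (Site d) → ℝ≥0∞} {G' : Set (Site d) → ℝ≥0∞}
    (h : ∀ C, e ∉ C → ∑ κ, Gs κ C ≤ m * G' C) :
    ∑ κ, nobleIotaCorr d p e (Gs κ) ≤ m * nobleIotaCorr d p e G' := by
  unfold nobleIotaCorr
  refine le_trans (sum_lintegral_le_lintegral_sum _ _ _) ?_
  rw [← lintegral_const_mul' _ _ hm]
  refine lintegral_mono fun ω => ?_
  by_cases hω : ω ∈ {ω : BondConfig (Site d) | e ∉ restrCluster 0 e 0 (offBonds {s(0, e)} ω)}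
  · simp only [Set.indicator_of_mem hω]
    exact h _ hω
  · simp only [Set.indicator_of_notMem hω, Finset.sum_const_zero, zero_le]

/-! ### D. The completed coefficients -/

/-- **`Σ_κ Ψ^{(N),κ} ≤ (2d−1) Ξ^{(N)}` in `[0,∞]`** (without the prefactor `p/μ_p`): for `N = 0` the factor
`1 − δ_{0,x}` makes both sides vanish at `x = 0`, and for `x ≠ 0` the start vertex `0` differs from `x`; for
`N ≥ 1` no side condition is needed. [cite: FitznerVanDerHofstad2017, (3.41)–(3.43) (arXiv:1506.07977v2 p. 28) and proof of Lemma 5.1 (§6.1)] -/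
theorem sum_noblePsiT_le (p : unitInterval) (N : ℕ) (x : Site d) :
    ∑ κ, noblePsiT d p (Percolation.stepVec κ) N x ≤ ((2 * d - 1 : ℕ) : ℝ≥0∞) * nobleXiT d p N x := by
  by_cases h : N = 0 ∧ x = 0
  · obtain ⟨rfl, rfl⟩ := h
    simp only [noblePsiT_zero_zero, Finset.sum_const_zero, zero_le]
  · simp only [noblePsiT, nobleXiT, if_neg h]
    cases N with
    | zero =>
      have hx : x ≠ 0 := fun hx => h ⟨rfl, hx⟩
      exact sum_noblePsiBT_zero_le p ∅ ∅ {0} fun h0 => absurd h0.symm hx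
    | succ N => exact sum_noblePsiBT_succ_le p ∅ ∅ {0} N 0 x

/-- Unfolding lemma for `Π^{(0),ι,κ}`. [cite: FitznerVanDerHofstad2017, (3.53) (arXiv:1506.07977v2 p. 29)] -/
theorem noblePiT_zero_apply (p : unitInterval) (e e' x : Site d) :
    noblePiT d p e e' 0 x = ENNReal.ofReal p * noblePsiBT d p {s(0, e)} ∅ e' 0 {e} 0 x := rfl

/-- Unfolding lemma for `Π^{(N+1),ι,κ}`. [cite: FitznerVanDerHofstad2017, (3.56) (arXiv:1506.07977v2 p. 30)] -/
theorem noblePiT_succ_apply (p : unitInterval) (e e' : Site d) (N : ℕ) (x : Site d) :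
    noblePiT d p e e' (N + 1) x = ENNReal.ofReal p * noblePsiBT d p {s(0, e)} ∅ e' (N + 1) {e} 0 x +
      ENNReal.ofReal p ^ 2 * nobleIotaCorr d p e (fun C => noblePsiBT d p (bondsAt {0}) {0} e' N C e x) := rfl

/-- Unfolding lemma for `Ξ^{(0),ι}`. [cite: FitznerVanDerHofstad2017, (3.53) (arXiv:1506.07977v2 p. 29)] -/
theorem nobleXiIotaT_zero_apply (p : unitInterval) (e x : Site d) :
    nobleXiIotaT d p e 0 x = nobleXiBT d p {s(0, e)} ∅ 0 {e} 0 x := rfl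

/-- Unfolding lemma for `Ξ^{(N+1),ι}`. [cite: FitznerVanDerHofstad2017, (3.55) (arXiv:1506.07977v2 p. 30)] -/
theorem nobleXiIotaT_succ_apply (p : unitInterval) (e : Site d) (N : ℕ) (x : Site d) :
    nobleXiIotaT d p e (N + 1) x = nobleXiBT d p {s(0, e)} ∅ (N + 1) {e} 0 x +
      ENNReal.ofReal p * nobleIotaCorr d p e (fun C => nobleXiBT d p (bondsAt {0}) {0} N C e x) := rfl

/-- **`Σ_κ Π^{(N),ι,κ} ≤ (2d−1) · p · Ξ^{(N),ι}` in `[0,∞]`** for a direction vector `e ≠ 0` (outer data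
`({b_ι}, ∅)` with `A = {e_ι} ∌ 0`, and the `𝔼_0^{b_ι}`-correction with `A = C̃^{b_ι}_0(0) ∌ e_ι`).
[cite: FitznerVanDerHofstad2017, (3.53), (3.55)–(3.56) (arXiv:1506.07977v2 pp. 29–30); §5 ("Bounds on Ψ^{(N),κ} and Π^{(N),ι,κ} follow from (3.74)"); proof of Lemma 5.1 (§6.1)] -/
theorem sum_noblePiT_le (p : unitInterval) {e : Site d} (he : e ≠ 0) :
    ∀ (N : ℕ) (x : Site d), ∑ κ, noblePiT d p e (Percolation.stepVec κ) N x ≤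
      ((2 * d - 1 : ℕ) : ℝ≥0∞) * (ENNReal.ofReal p * nobleXiIotaT d p e N x)
  | 0, x => by
    simp only [noblePiT_zero_apply, nobleXiIotaT_zero_apply]
    rw [← Finset.mul_sum, mul_left_comm]
    refine mul_le_mul' le_rfl (sum_noblePsiBT_zero_le p {s(0, e)} ∅ {e} fun _ => ?_)
    rw [Set.mem_singleton_iff]
    exact fun h0 => he h0.symm
  | N + 1, x => by
    simp only [noblePiT_succ_apply, nobleXiIotaT_succ_apply]
    rw [Finset.sum_add_distrib, ← Finset.mul_sum, ← Finset.mul_sum]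
    calc ENNReal.ofReal p * ∑ κ, noblePsiBT d p {s(0, e)} ∅ (Percolation.stepVec κ) (N + 1) {e} 0 x +
          ENNReal.ofReal p ^ 2 * ∑ κ, nobleIotaCorr d p e
            (fun C => noblePsiBT d p (bondsAt {0}) {0} (Percolation.stepVec κ) N C e x)
        ≤ ENNReal.ofReal p * (((2 * d - 1 : ℕ) : ℝ≥0∞) * nobleXiBT d p {s(0, e)} ∅ (N + 1) {e} 0 x) +
          ENNReal.ofReal p ^ 2 * (((2 * d - 1 : ℕ) : ℝ≥0∞) *
            nobleIotaCorr d p e (fun C => nobleXiBT d p (bondsAt {0}) {0} N C e x)) :=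
          add_le_add (mul_le_mul' le_rfl (sum_noblePsiBT_succ_le p _ _ _ N 0 x))
            (mul_le_mul' le_rfl (sum_nobleIotaCorr_le p e (ENNReal.natCast_ne_top _)
              fun C hC => sum_noblePsiBT_le p (bondsAt {0}) {0} C N fun _ => hC))
      _ = ((2 * d - 1 : ℕ) : ℝ≥0∞) * (ENNReal.ofReal p * (nobleXiBT d p {s(0, e)} ∅ (N + 1) {e} 0 x +
          ENNReal.ofReal p * nobleIotaCorr d p e (fun C => nobleXiBT d p (bondsAt {0}) {0} N C e x))) := by
          ring

/-! ### E. The summed relations `NobleRelationSummedAt d p` for `0 < p < p_c` -/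

/-- The cast identity `((2d − 1 : ℕ) : ℝ) = 2d − 1` for `d ≥ 1`. [folklore] -/
theorem cast_two_mul_sub_one (hd : 1 ≤ d) : ((2 * d - 1 : ℕ) : ℝ) = 2 * (d : ℝ) - 1 := by
  rw [Nat.cast_sub (by omega : 1 ≤ 2 * d)]
  push_cast
  ring

/-- **The `κ`-summed relations hold for percolation on `0 < p < p_c` (`d ≥ 2`)**:
`Σ_κ Ψ^{(N),κ}_p(x) ≤ (2d−1)(p/μ_p) Ξ^{(N)}_p(x)` and `Σ_κ Π^{(N),ι,κ}_p(x) ≤ (2d−1) p Ξ^{(N),ι}_p(x)` for all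
`N`, `ι`, `x` — "for each realisation at most `2d−1` values of `κ` can contribute".  This DISCHARGES the hypothesis
`NobleRelationSummedAt d p` of `FitznerVanDerHofstad2016NoBLE_prop45ii` / `nobleImprovementInputsAt_of_prop45ii`
on `(p_I, p_c) ⊆ (0, p_c)`.
[cite: FitznerVanDerHofstad2017, proof of Lemma 5.1 (arXiv:1506.07977v2 §6.1: "For each realisation at most 2d−1 values of κ can contribute … The argument … also implies that Σ_κ Ψ^{(N),κ}_p(x) ≤ (2d−1)(p/μ_p)Ξ^{(N)}_p(x)"); §5 ((3.74) and "Bounds on … Π^{(N),ι,κ} follow from (3.74)")] -/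
theorem nobleRelationSummedAt_of_lt_criticalProbI (hd : 2 ≤ d) {p : unitInterval} (hp0 : 0 < (p : ℝ))
    (hp : p < criticalProbI d) : NobleRelationSummedAt d p := by
  have hp1 : (p : ℝ) < 1 :=
    lt_of_lt_of_le (show (p : ℝ) < (criticalProbI d : ℝ) by exact_mod_cast hp) (criticalProbI d).2.2
  have hμ : 0 ≤ (p : ℝ) / nobleMu d p := div_nonneg hp0.le (nobleMu_pos (by omega) hp0 hp1).le
  have hcast : ((2 * d - 1 : ℕ) : ℝ) = 2 * (d : ℝ) - 1 := cast_two_mul_sub_one (by omega)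
  refine ⟨fun N x => ?_, fun N ι x => ?_⟩
  · have hfin : nobleXiT d p N x ≠ ∞ := nobleXiT_ne_top hd hp N x
    have hfinκ : ∀ κ, noblePsiT d p (Percolation.stepVec κ) N x ≠ ∞ := fun κ =>
      ne_top_of_le_ne_top hfin (noblePsiT_le_nobleXiT p _ N x)
    have hT := sum_noblePsiT_le p N x
    simp only [noblePsiN_def, nobleXiN_def]
    rw [← Finset.mul_sum, ← ENNReal.toReal_sum fun κ _ => hfinκ κ]
    calc (p : ℝ) / nobleMu d p * (∑ κ, noblePsiT d p (Percolation.stepVec κ) N x).toReal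
        ≤ (p : ℝ) / nobleMu d p * ((((2 * d - 1 : ℕ) : ℝ≥0∞) * nobleXiT d p N x).toReal) :=
          mul_le_mul_of_nonneg_left
            (ENNReal.toReal_mono (ENNReal.mul_ne_top (ENNReal.natCast_ne_top _) hfin) hT) hμ
      _ = (2 * d - 1) * ((p : ℝ) / nobleMu d p) * (nobleXiT d p N x).toReal := by
          rw [ENNReal.toReal_mul, ENNReal.toReal_natCast, hcast]
          ring
  · have he : Percolation.stepVec ι ≠ (0 : Site d) := percolationStepVec_ne_zero ι
    have hfin : nobleXiIotaT d p (Percolation.stepVec ι) N x ≠ ∞ := nobleXiIotaT_ne_top hd hp _ N x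
    have hfin' : ENNReal.ofReal p * nobleXiIotaT d p (Percolation.stepVec ι) N x ≠ ∞ :=
      ENNReal.mul_ne_top ENNReal.ofReal_ne_top hfin
    have hfinκ : ∀ κ, noblePiT d p (Percolation.stepVec ι) (Percolation.stepVec κ) N x ≠ ∞ := fun κ =>
      ne_top_of_le_ne_top hfin' (noblePiT_le p _ _ N x)
    have hT := sum_noblePiT_le p he N x
    simp only [noblePiN, nobleXiIotaN]
    rw [← ENNReal.toReal_sum fun κ _ => hfinκ κ]
    calc (∑ κ, noblePiT d p (Percolation.stepVec ι) (Percolation.stepVec κ) N x).toReal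
        ≤ ((((2 * d - 1 : ℕ) : ℝ≥0∞)) * (ENNReal.ofReal p * nobleXiIotaT d p (Percolation.stepVec ι) N x)).toReal :=
          ENNReal.toReal_mono (ENNReal.mul_ne_top (ENNReal.natCast_ne_top _) hfin') hT
      _ = (2 * d - 1) * (p : ℝ) * (nobleXiIotaT d p (Percolation.stepVec ι) N x).toReal := by
          rw [ENNReal.toReal_mul, ENNReal.toReal_mul, ENNReal.toReal_ofReal p.2.1, ENNReal.toReal_natCast, hcast]
          ring

/-- The summed relations on the NoBLE window `(p_I, p_c)` (where `0 < p_I`).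
[cite: FitznerVanDerHofstad2017, proof of Lemma 5.1 (arXiv:1506.07977v2 §6.1)] -/
theorem nobleRelationSummedAt_of_mem_Ioo (hd : 2 ≤ d) {p : unitInterval}
    (hp : p ∈ Set.Ioo (nbwThresholdI d) (criticalProbI d)) : NobleRelationSummedAt d p :=
  nobleRelationSummedAt_of_lt_criticalProbI hd
    (lt_trans (nbwThresholdI_pos (by omega)) (show (nbwThresholdI d : ℝ) < p by exact_mod_cast hp.1)) hp.2

/-- **Bookkeeping with the summed-relation hypothesis discharged.**  Same as
`nobleImprovementInputsAt_of_prop45ii` (module `NobleAssumptions`) WITHOUT its binder `hSum`: the `κ`-summed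
relations (D43) are now the theorem `nobleRelationSummedAt_of_lt_criticalProbI`.  The binder `hfact` is still the
HYBRID `FitznerVanDerHofstad2016NoBLE_prop45ii` (printed Prop. 4.5(ii) + the notebook wiring of the `β`'s, D29) —
NOT a published theorem; after this corollary its only non-printed content is the wiring D29 (the extra hypothesis
over print, D43, being proved here). [cite: FitznerVanDerHofstad2016NoBLE, Prop. 4.5(ii) (p. 1088) and App. D (pp. 1110–1118)] -/
theorem nobleImprovementInputsAt_of_prop45ii_summed (hd : 2 ≤ d)
    (hfact : FitznerVanDerHofstad2016NoBLE_prop45ii d)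
    {cμ : ℝ} {c : Fin 6 → ℝ} {Γ : Fin 3 → ℝ} {i : BetaMap.Inputs} {b : Fin 6 → ℝ} (hWF : NobleInputsWF d i)
    (hEq : ∀ p : unitInterval, p ∈ Set.Ioo (nbwThresholdI d) (criticalProbI d) →
      PercolationNobleEquationAt d p)
    (h43 : ∀ p : unitInterval, p ∈ Set.Ioo (nbwThresholdI d) (criticalProbI d) →
      (∀ j, nobleF d cμ c j p ≤ Γ j) →
        ∃ S : NobleSplit d p, NobleAssumption41At d p S ∧ NobleAssumption43At d p S i ∧
          NobleWeightedDiagramBoundAt d p b) :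
    NobleImprovementInputsAt d cμ c Γ (BetaMap.nobleBetaOfInputs d i) b :=
  nobleImprovementInputsAt_of_prop45ii hd hfact hWF hEq (fun _ hp => nobleRelationSummedAt_of_mem_Ioo hd hp) h43

end Literature.Probability.FitznerVanDerHofstad2017

end
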